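import Literature.Probability.Percolation.Z2PivotalCampbellLimit
import Literature.Probability.Percolation.FlipFairKernel
import Literature.Probability.Distributions.JointLawClosedConstraint
import Literature.Probability.Distributions.LintegralDeterminingClass
import Summits.CriticalPhenomena.CardyFormulaZ2.Theorems.CardyMeckeFlipFlipErgodicityZ2StubLatticePivotalAntitone

/-!
# Crux `FlipErgodicityZ2` (stmt-CriticalPhenomena-14825), line `registered`, stub
# `stub_kernelExistsZ2_of_lattice`: antitonicity in the cutoff passes to joint limits (ADM)(2)

Route `Summits/CriticalPhenomena/CardyFormulaZ2/Theses/CardyMeckeFlip`.  Helper file (supports the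
crux item).  Clause (ADM)(2) of admissibility of the Garban–Pete–Schramm kernel of a bond-`ℤ²`
sublimit `μ` asks that the cutoff kernels be antitone, `M ε S ≤ M ε' S` for `0 < ε' ≤ ε`.  Its
LATTICE side is the first hypothesis of the stub (landed as `stub_latticePivotalAntitone`,
p149777): `w_e(ε) ≤ w_e(ε')` for every edge once `δ ≤ ε'`, on lattice configurations.  This
file proves the LIMIT PASSAGE, for any pair of cutoffs and ANY joint limit in law of the
configuration with the two lattice kernels in which the limit random measures are measurable
functions `M₀ ε S`, `M₀ ε' S` of the limit configuration with locally integrable masses: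

  `ae_kernel_le_of_jointLimit : … → ∀ᵐ S ∂μ, M₀ ε S ≤ M₀ ε' S`.

Proof.  For each `φ ≥ 0` in the countable determining class `Φ ⊆ C_c(ℂ)` of
`LintegralDeterminingClass.lean`: on the lattice `⟨μ^ε_δ(ω), φ⟩ ≤ ⟨μ^ε'_δ(ω), φ⟩` almost surely
for `δ ≤ ε'` (`integral_z2PivotalMeasure_le_of_antitone`); closed constraints pass to joint
limits in law (`ae_le_of_tendsto_pair`, `JointLawClosedConstraint.lean`), so
`⟨M₀ ε S, φ⟩ ≤ ⟨M₀ ε' S, φ⟩` a.s.; almost every `S` has both kernels finite on compacts (local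
integrability), where Bochner integrals are `ofReal`-lintegrals; the determining class turns the
countably many inequalities into `M₀ ε S ≤ M₀ ε' S`.
-/

noncomputable section

open MeasureTheory Set Filter Metric
open Literature.Probability.Percolation Literature.Probability.Percolation.QuadCrossing
open Literature.Probability.LatticeModels Literature.Probability.Distributions
open scoped ENNReal Topology

namespace Summit.CriticalPhenomena.CardyFormulaZ2.Theorems.CardyMeckeFlip

/-! ### Lattice side: the functionals of a non-negative test function are antitone in the cutoff -/

/-- **`⟨μ^ε_δ(ω), φ⟩ ≤ ⟨μ^ε'_δ(ω), φ⟩`** for `φ ≥ 0` in `C_c(ℂ)`, `0 < δ ≤ ε' ≤ ε` and a lattice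
configuration `ω`, given antitonicity of the averaged weights (the stub's first hypothesis).
[folklore] -/
theorem integral_z2PivotalMeasure_le_of_antitone
    (hanti : ∀ (ε ε' δ : ℝ), 0 < δ → δ ≤ ε' → ε' ≤ ε →
      ∀ (ω : BondConfig (Site 2)), ω ⊆ (zdGraph 2).edgeSet → ∀ (x : Site 2) (i : Fin 2),
        pivotalWeight ε δ ω x i ≤ pivotalWeight ε' δ ω x i)
    {ε ε' δ : ℝ} (hδ : 0 < δ) (hδε' : δ ≤ ε') (hle : ε' ≤ ε) {ω : BondConfig (Site 2)}
    (hω : ω ⊆ (zdGraph 2).edgeSet) {φ : ℂ → ℝ} (hφ : Continuous φ) (hφc : HasCompactSupport φ)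
    (h0 : ∀ x, 0 ≤ φ x) :
    ∫ x, φ x ∂(z2PivotalMeasure ε δ ω) ≤ ∫ x, φ x ∂(z2PivotalMeasure ε' δ ω) := by
  obtain ⟨E, hE⟩ := exists_finset_of_hasCompactSupport hδ hφc
  rw [integral_z2PivotalMeasure_eq_sum ε hδ ω hφ hφc E hE,
    integral_z2PivotalMeasure_eq_sum ε' hδ ω hφ hφc E hE]
  refine Finset.sum_le_sum fun p _ => mul_le_mul_of_nonneg_right ?_ (h0 _)
  exact ENNReal.toReal_mono ((pivotalWeight_le ε' δ ω p.1 p.2).trans_lt ENNReal.ofReal_lt_top).ne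
    (hanti ε ε' δ hδ hδε' hle ω hω p.1 p.2)

/-! ### Local finiteness of almost every limit kernel from local integrability -/

/-- A measurable kernel on `ℂ` with locally integrable masses is almost surely finite on
compact sets. [folklore] -/
theorem ae_isFiniteMeasureOnCompacts_of_lintegral_closedBall_lt_top
    {X : Type*} [MeasurableSpace X] {ν : Measure X} {K : X → Measure ℂ} (hK : Measurable K)
    (hfin : ∀ r : ℝ, ∫⁻ S, K S (closedBall 0 r) ∂ν < ⊤) :
    ∀ᵐ S ∂ν, IsFiniteMeasureOnCompacts (K S) := by
  have hn : ∀ n : ℕ, ∀ᵐ S ∂ν, K S (closedBall 0 n) < ⊤ := fun n =>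
    ae_lt_top ((Measure.measurable_coe measurableSet_closedBall).comp hK) (hfin n).ne
  filter_upwards [ae_all_iff.2 hn] with S hS
  refine ⟨fun C hC => ?_⟩
  obtain ⟨r, hr⟩ := hC.isBounded.subset_closedBall (0 : ℂ)
  obtain ⟨n, hn'⟩ := exists_nat_ge r
  exact (measure_mono (hr.trans (closedBall_subset_closedBall hn'))).trans_lt (hS n)

/-! ### The limit passage of antitonicity -/

/-- **Antitonicity in the cutoff passes to every joint limit in law** (the limit side of clause
(ADM)(2)).  Data: the stub's lattice antitonicity; a mesh sequence `δ_k → 0⁺`; two cutoffs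
`0 < ε' ≤ ε`; measurable kernels `M₀ ε, M₀ ε' : ℋ → Measure ℂ` with locally `μ`-integrable
masses; and the JOINT convergence in law, for every `φ ∈ C_c(ℂ)`, of
`(ω_{δ_k}, ⟨μ^ε_{δ_k}, φ⟩, ⟨μ^ε'_{δ_k}, φ⟩)` to `(S, ⟨M₀ ε S, φ⟩, ⟨M₀ ε' S, φ⟩)`, `S ∼ μ`
(bounded continuous test functions of `ℋ × ℝ²`).  Conclusion: `M₀ ε S ≤ M₀ ε' S` for `μ`-a.e.
`S`. [folklore] -/
theorem ae_kernel_le_of_jointLimit'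
    (hanti : ∀ (ε ε' δ : ℝ), 0 < δ → δ ≤ ε' → ε' ≤ ε →
      ∀ (ω : BondConfig (Site 2)), ω ⊆ (zdGraph 2).edgeSet → ∀ (x : Site 2) (i : Fin 2),
        pivotalWeight ε δ ω x i ≤ pivotalWeight ε' δ ω x i)
    (μ : FiniteMeasure (QuadConfig (univ : Set ℂ)))
    (M₀ : ℝ → QuadConfig (univ : Set ℂ) → Measure ℂ) (δs : ℕ → ℝ) (hpos : ∀ k, 0 < δs k)
    (h0 : Tendsto δs atTop (𝓝 0)) {ε ε' : ℝ} (hε' : 0 < ε') (hle : ε' ≤ ε)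
    (hM : Measurable (M₀ ε)) (hM' : Measurable (M₀ ε'))
    (hfin : ∀ r : ℝ, ∫⁻ S, M₀ ε S (closedBall 0 r) ∂(μ : Measure (QuadConfig (univ : Set ℂ))) < ⊤)
    (hfin' : ∀ r : ℝ,
      ∫⁻ S, M₀ ε' S (closedBall 0 r) ∂(μ : Measure (QuadConfig (univ : Set ℂ))) < ⊤)
    (hjoint : ∀ φ : ℂ → ℝ, Continuous φ → HasCompactSupport φ →
      ∀ F : BoundedContinuousFunction (QuadConfig (univ : Set ℂ) × (Fin 2 → ℝ)) ℝ,
        Tendsto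
          (fun k => ∫ ω, F (z2QuadConfig (univ : Set ℂ) (δs k) ω,
              ![∫ x, φ x ∂(z2PivotalMeasure ε (δs k) ω), ∫ x, φ x ∂(z2PivotalMeasure ε' (δs k) ω)])
            ∂(bondPercolation (zdGraph 2) half))
          atTop
          (𝓝 (∫ S, F (S, ![∫ x, φ x ∂(M₀ ε S), ∫ x, φ x ∂(M₀ ε' S)])
            ∂(μ : Measure (QuadConfig (univ : Set ℂ)))))) :
    ∀ᵐ S ∂(μ : Measure (QuadConfig (univ : Set ℂ))), M₀ ε S ≤ M₀ ε' S := by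
  have hε : 0 < ε := hε'.trans_le hle
  -- the countable determining class
  obtain ⟨Φ, hΦc, hΦ, hdet⟩ := exists_countable_determining_le ℂ
  -- for each `φ ∈ Φ`, the a.s. inequality of the limit functionals
  have hineq : ∀ φ ∈ Φ, ∀ᵐ S ∂(μ : Measure (QuadConfig (univ : Set ℂ))),
      ∫ x, φ x ∂(M₀ ε S) ≤ ∫ x, φ x ∂(M₀ ε' S) := by
    intro φ hφΦ
    obtain ⟨hφ, hφc, hφ01⟩ := hΦ φ hφΦ
    have hw : ∀ j : Fin 2, Measurable fun S : QuadConfig (univ : Set ℂ) =>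
        (![∫ x, φ x ∂(M₀ ε S), ∫ x, φ x ∂(M₀ ε' S)] : Fin 2 → ℝ) j := by
      intro j
      fin_cases j
      · simpa using measurable_integral_of_measurable_measure hM hφ.stronglyMeasurable
      · simpa using measurable_integral_of_measurable_measure hM' hφ.stronglyMeasurable
    have hv : ∀ᶠ k in atTop, ∀ᵐ ω ∂(bondPercolation (zdGraph 2) half),
        (![∫ x, φ x ∂(z2PivotalMeasure ε (δs k) ω),
            ∫ x, φ x ∂(z2PivotalMeasure ε' (δs k) ω)] : Fin 2 → ℝ) 0 ≤
          (![∫ x, φ x ∂(z2PivotalMeasure ε (δs k) ω),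
            ∫ x, φ x ∂(z2PivotalMeasure ε' (δs k) ω)] : Fin 2 → ℝ) 1 := by
      filter_upwards [h0.eventually (Iic_mem_nhds hε')] with k hk
      filter_upwards [ae_subset_edgeSet (zdGraph 2) half] with ω hω
      simpa using integral_z2PivotalMeasure_le_of_antitone hanti (hpos k) hk hle hω hφ hφc
        fun x => (hφ01 x).1
    have := ae_le_of_tendsto_pair (μ := (μ : Measure (QuadConfig (univ : Set ℂ))))
      (X := fun k => z2QuadConfig (univ : Set ℂ) (δs k))
      (v := fun k ω => ![∫ x, φ x ∂(z2PivotalMeasure ε (δs k) ω),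
        ∫ x, φ x ∂(z2PivotalMeasure ε' (δs k) ω)])
      (w := fun S => ![∫ x, φ x ∂(M₀ ε S), ∫ x, φ x ∂(M₀ ε' S)]) (hjoint φ hφ hφc) hw 0 1 hv
    simpa using this
  -- almost every `S`: both kernels finite on compacts and all inequalities
  have hall := (ae_ball_iff hΦc).2 hineq
  filter_upwards [hall, ae_isFiniteMeasureOnCompacts_of_lintegral_closedBall_lt_top hM hfin,
    ae_isFiniteMeasureOnCompacts_of_lintegral_closedBall_lt_top hM' hfin'] with S hS hSfin hSfin'
  haveI := hSfin
  haveI := hSfin'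
  refine hdet (M₀ ε' S) (M₀ ε S) inferInstance fun φ hφΦ => ?_
  obtain ⟨hφ, hφc, hφ01⟩ := hΦ φ hφΦ
  rw [← ofReal_integral_eq_lintegral_ofReal (hφ.integrable_of_hasCompactSupport hφc)
      (ae_of_all _ fun x => (hφ01 x).1),
    ← ofReal_integral_eq_lintegral_ofReal (hφ.integrable_of_hasCompactSupport hφc)
      (ae_of_all _ fun x => (hφ01 x).1)]
  exact ENNReal.ofReal_le_ofReal (hS φ hφΦ)

/-- **Antitonicity in the cutoff passes to every joint limit in law** — the registered helper
headline (verbatim signature; see `ae_kernel_le_of_jointLimit'` for the proof with named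
hypotheses): lattice antitonicity of the averaged weights, a mesh sequence `δ_k → 0⁺`, two
cutoffs `0 < ε' ≤ ε`, measurable locally integrable kernels, and the joint convergence in law of
`(ω_{δ_k}, ⟨μ^ε_{δ_k}, φ⟩, ⟨μ^ε'_{δ_k}, φ⟩)` to `(S, ⟨M₀ ε S, φ⟩, ⟨M₀ ε' S, φ⟩)` for every
`φ ∈ C_c(ℂ)` give `M₀ ε S ≤ M₀ ε' S` almost surely. [folklore] -/
theorem ae_kernel_le_of_jointLimit :
    (∀ (ε ε' δ : ℝ), 0 < δ → δ ≤ ε' → ε' ≤ ε →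
      ∀ (ω : BondConfig (Site 2)), ω ⊆ (zdGraph 2).edgeSet → ∀ (x : Site 2) (i : Fin 2),
        pivotalWeight ε δ ω x i ≤ pivotalWeight ε' δ ω x i) →
    ∀ (μ : FiniteMeasure (QuadConfig (Set.univ : Set ℂ)))
      (M₀ : ℝ → QuadConfig (Set.univ : Set ℂ) → Measure ℂ) (δs : ℕ → ℝ),
      (∀ k, 0 < δs k) → Tendsto δs atTop (𝓝 0) → ∀ {ε ε' : ℝ}, 0 < ε' → ε' ≤ ε →
        Measurable (M₀ ε) → Measurable (M₀ ε') →
          (∀ r : ℝ, ∫⁻ S, M₀ ε S (Metric.closedBall 0 r)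
            ∂(μ : Measure (QuadConfig (Set.univ : Set ℂ))) < ⊤) →
          (∀ r : ℝ, ∫⁻ S, M₀ ε' S (Metric.closedBall 0 r)
            ∂(μ : Measure (QuadConfig (Set.univ : Set ℂ))) < ⊤) →
          (∀ φ : ℂ → ℝ, Continuous φ → HasCompactSupport φ →
            ∀ F : BoundedContinuousFunction (QuadConfig (Set.univ : Set ℂ) × (Fin 2 → ℝ)) ℝ,
              Tendsto
                (fun k => ∫ ω, F (z2QuadConfig (Set.univ : Set ℂ) (δs k) ω,
                    ![∫ x, φ x ∂(z2PivotalMeasure ε (δs k) ω),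
                      ∫ x, φ x ∂(z2PivotalMeasure ε' (δs k) ω)])
                  ∂(bondPercolation (zdGraph 2) half))
                atTop
                (𝓝 (∫ S, F (S, ![∫ x, φ x ∂(M₀ ε S), ∫ x, φ x ∂(M₀ ε' S)])
                  ∂(μ : Measure (QuadConfig (Set.univ : Set ℂ)))))) →
            ∀ᵐ S ∂(μ : Measure (QuadConfig (Set.univ : Set ℂ))), M₀ ε S ≤ M₀ ε' S := by
  intro hanti μ M₀ δs hpos h0 ε ε' hε' hle hM hM' hfin hfin' hjoint
  exact ae_kernel_le_of_jointLimit' hanti μ M₀ δs hpos h0 hε' hle hM hM' hfin hfin' hjoint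

end Summit.CriticalPhenomena.CardyFormulaZ2.Theorems.CardyMeckeFlip

end
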